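import Mathlib
import Summits.PneNP.PneNP.Theorems.CnfIdealGenLengthRankDefectRepresentationsTwoFamilyCutDomination
import Literature.LinearAlgebra.Matrix.RankMinors

/-!
# Crux `RankDefectRepresentations` (stmt-PneNP-18923), line `rank-dehn-ladder`: the SPREAD LEMMA — the maximal rectangle rank of a
# two-family instance is at most sixteen times the AVERAGE rectangle rank (lead g12)

Setting of the registered tool stub `stub_coreLinear` / of `DoubleMaxCutDecomposition` (p653152): rows and columns of `D` carry an
I-colour and a J-colour; for `B ⊆` I-colours and `B′ ⊆` J-colours the RECTANGLE `R(B,B′)` is the block of rows coloured in `B × B′`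
against columns coloured in `Bᶜ × B′ᶜ` (a summand of the double bipartition cut), written here as the masked matrix
`D ∘ 1[(I∈B ∧ J∈B′) × (I∉B ∧ J∉B′)]`.

`card · rank R(B₀,B′₀) ≤ 16 · Σ_{B,B′} rank R(B,B′)` (`card_mul_rank_rect_le_sixteen_mul_sum`): the maximum over rectangles is at most
16 times the average over ALL pairs `(B,B′)` of colour sets.  Proof: an invertible `s × s` minor of `R(B₀,B′₀)` (`s` = its rank, from
`Literature.LinearAlgebra.Matrix.exists_det_submatrix_ne_zero_of_le_rank`) has its rows coloured in `B₀ × B′₀` and its columns in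
`B₀ᶜ × B′₀ᶜ`; for every `(B,B′)` the rectangle `R(B,B′)` contains the minor's rows coloured in `B × B′` against its columns coloured in
`Bᶜ × B′ᶜ`.  The Klein four-group generated by `B ↦ B ∆ P` and `B′ ↦ B′ ∆ Q` (`P`, `Q` = the I- and J-colours of the minor's columns, disjoint
from those of its rows) fixes the surviving row set and permutes the four classes of columns, whose masked pieces sum to the full set of
surviving rows of an invertible matrix; so the four rectangle ranks of an orbit add up to at least the number of surviving rows, and each
row survives in a quarter of all `(B,B′)`.
USE: it makes the AVERAGED form of the linear conjecture (`mc ≤ C·𝔼_{B,B′} rank R(B,B′)`, memo `Lines/rank-dehn-ladder-g11.md` §11,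
`…-g12.md` §3) EQUIVALENT to `stub_coreLinear` up to the factor 16, for provers (potential arguments) and refuters (average targets) alike;
it was used informally by leads g9 (§3(iv)) and g11 (§11).
HONEST FRAMING: elementary; a helper (`--supports`) for the crux; the registered stubs are untouched; P ≠ NP is not moved; F-N2 is a
FRONTIER formal rung.
-/

set_option linter.dupNamespace false -- `Summit.PneNP.PneNP.…`: summit = sub-problem name (D-0017)

namespace Summit.PneNP.PneNP.Theorems.CnfIdealGenLengthRankDefectRepresentationsRectangleSpread

open Finset Matrix
open scoped symmDiff
open Summit.PneNP.PneNP.Theorems.CnfIdealGenLengthRankDefectRepresentationsTwoFamilyCutDomination (colourI colourJ)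
open Summit.PneNP.PneNP.Theorems.CnfIdealGenLengthRankDefectRepresentationsMergeLowerBound (rank_add_le' rank_sum_le')
open Literature.LinearAlgebra.Matrix (exists_det_submatrix_ne_zero_of_le_rank)

variable {K : Type} [Field K]

section Tools

variable {s : ℕ}

/-- Masking the rows of an invertible matrix to a set `S` (zero elsewhere) leaves rank `|S|`. -/
theorem rank_rowMask_of_det_ne_zero (M : Matrix (Fin s) (Fin s) K) (hM : M.det ≠ 0) (S : Fin s → Prop)
    [DecidablePred S] :
    (Matrix.of fun a b => if S a then M a b else 0).rank = Fintype.card {a : Fin s // S a} := by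
  classical
  have e : (Matrix.of fun a b => if S a then M a b else 0) =
      Matrix.diagonal (fun a => if S a then (1 : K) else 0) * M := by
    ext a b
    simp only [Matrix.of_apply, Matrix.diagonal_mul]
    split_ifs <;> simp
  rw [e, Matrix.rank_mul_eq_left_of_isUnit_det M _ (isUnit_iff_ne_zero.mpr hM), Matrix.rank_diagonal]
  exact Fintype.card_congr (Equiv.subtypeEquivRight fun a => by simp)

/-- The four column classes of a row-masked invertible matrix carry, together, at least `|S|` rank. -/
theorem card_le_sum_four_masks (M : Matrix (Fin s) (Fin s) K) (hM : M.det ≠ 0) (S : Fin s → Prop)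
    [DecidablePred S] (u v : Fin s → Bool) :
    Fintype.card {a : Fin s // S a} ≤
      (Matrix.of fun a b => if S a ∧ (u b = true ∧ v b = true) then M a b else 0).rank +
      (Matrix.of fun a b => if S a ∧ (u b = false ∧ v b = true) then M a b else 0).rank +
      (Matrix.of fun a b => if S a ∧ (u b = true ∧ v b = false) then M a b else 0).rank +
      (Matrix.of fun a b => if S a ∧ (u b = false ∧ v b = false) then M a b else 0).rank := by
  classical
  have e : (Matrix.of fun a b => if S a then M a b else 0) =
      (Matrix.of fun a b => if S a ∧ (u b = true ∧ v b = true) then M a b else 0) +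
      (Matrix.of fun a b => if S a ∧ (u b = false ∧ v b = true) then M a b else 0) +
      (Matrix.of fun a b => if S a ∧ (u b = true ∧ v b = false) then M a b else 0) +
      (Matrix.of fun a b => if S a ∧ (u b = false ∧ v b = false) then M a b else 0) := by
    ext a b
    simp only [Matrix.of_apply, Matrix.add_apply]
    by_cases h : S a
    · cases hu : u b <;> cases hv : v b <;> simp [h]
    · simp [h]
  rw [← rank_rowMask_of_det_ne_zero M hM S, e]
  refine (rank_add_le' _ _).trans ?_
  refine Nat.add_le_add_right ((rank_add_le' _ _).trans ?_) _
  exact Nat.add_le_add_right (rank_add_le' _ _) _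

/-- Half of all finite subsets of a finite type contain a given element:
`2 · #{B : p ∈ B} = #(all B)`, written as a sum of indicators. -/
theorem two_mul_sum_indicator_mem {α : Type} [Fintype α] [DecidableEq α] (p : α) :
    2 * ∑ B : Finset α, (if p ∈ B then 1 else 0) = Fintype.card (Finset α) := by
  have flip : ∑ B : Finset α, (if p ∈ B then 1 else 0) = ∑ B : Finset α, (if p ∉ B then 1 else 0) := by
    refine Fintype.sum_equiv (Equiv.mk (fun B => B ∆ {p}) (fun B => B ∆ {p})
      (fun B => symmDiff_symmDiff_cancel_right _ _) (fun B => symmDiff_symmDiff_cancel_right _ _)) _ _ ?_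
    intro B
    simp only [Equiv.coe_fn_mk, Finset.mem_symmDiff, Finset.mem_singleton]
    by_cases h : p ∈ B <;> simp [h]
  have tot : ∑ B : Finset α, ((if p ∈ B then 1 else 0) + (if p ∉ B then 1 else 0)) = Fintype.card (Finset α) := by
    rw [← Finset.card_univ, Finset.card_eq_sum_ones]
    refine Finset.sum_congr rfl fun B _ => ?_
    by_cases h : p ∈ B <;> simp [h]
  rw [two_mul, Finset.sum_add_distrib.symm.trans tot |>.symm, flip]

end Tools

variable {n n' : ℕ} {ι ι' : Type} [Fintype ι] [Fintype ι']

/-- **SPREAD LEMMA.**  For every rectangle `(B₀,B′₀)`: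
`#(B) · #(B′) · rank R(B₀,B′₀) ≤ 16 · Σ_{B,B′} rank R(B,B′)` — the maximal rectangle rank is at most 16 times the average rectangle rank
over all pairs of colour sets. -/
theorem card_mul_rank_rect_le_sixteen_mul_sum (row : ι → Fin n ⊕ Fin n' → Bool) (col : ι' → Fin n ⊕ Fin n' → Bool)
    (D : Matrix ι ι' K) (B₀ : Finset (Fin n → Bool)) (B₀' : Finset (Fin n' → Bool)) :
    Fintype.card (Finset (Fin n → Bool)) * Fintype.card (Finset (Fin n' → Bool)) *
        (Matrix.of fun x y => if (colourI (row x) ∈ B₀ ∧ colourJ (row x) ∈ B₀') ∧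
            (colourI (col y) ∉ B₀ ∧ colourJ (col y) ∉ B₀') then D x y else 0).rank ≤
      16 * ∑ B : Finset (Fin n → Bool), ∑ B' : Finset (Fin n' → Bool),
        (Matrix.of fun x y => if (colourI (row x) ∈ B ∧ colourJ (row x) ∈ B') ∧
            (colourI (col y) ∉ B ∧ colourJ (col y) ∉ B') then D x y else 0).rank := by
  classical
  set R₀ : Matrix ι ι' K := Matrix.of fun x y => if (colourI (row x) ∈ B₀ ∧ colourJ (row x) ∈ B₀') ∧
      (colourI (col y) ∉ B₀ ∧ colourJ (col y) ∉ B₀') then D x y else 0 with hR₀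
  set s := R₀.rank with hs
  -- an invertible `s × s` minor of the rectangle
  obtain ⟨r, c, -, -, hdet⟩ := exists_det_submatrix_ne_zero_of_le_rank R₀ (le_refl s)
  set M : Matrix (Fin s) (Fin s) K := R₀.submatrix r c with hM
  -- its rows are coloured in `B₀ × B₀'`, its columns in `B₀ᶜ × B₀'ᶜ`
  have hrow : ∀ a, colourI (row (r a)) ∈ B₀ ∧ colourJ (row (r a)) ∈ B₀' := by
    intro a
    by_contra h
    apply hdet
    refine Matrix.det_eq_zero_of_row_eq_zero a fun b => ?_
    simp [hM, hR₀, h]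
  have hcol : ∀ b, colourI (col (c b)) ∉ B₀ ∧ colourJ (col (c b)) ∉ B₀' := by
    intro b
    by_contra h
    apply hdet
    refine Matrix.det_eq_zero_of_column_eq_zero b fun a => ?_
    simp only [hM, hR₀, Matrix.submatrix_apply, Matrix.of_apply]
    rw [if_neg]
    exact fun h' => h h'.2
  -- notation for the surviving rows / columns of the minor inside `R(B,B')`
  let pS : Finset (Fin n → Bool) → Finset (Fin n' → Bool) → Fin s → Prop :=
    fun B B' a => colourI (row (r a)) ∈ B ∧ colourJ (row (r a)) ∈ B'
  let f : Finset (Fin n → Bool) → Finset (Fin n' → Bool) → ℕ := fun B B' =>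
    (Matrix.of fun a b => if pS B B' a ∧ (colourI (col (c b)) ∉ B ∧ colourJ (col (c b)) ∉ B') then M a b else 0).rank
  -- Step A: every rectangle contains the corresponding masked piece of the minor
  have stepA : ∀ B B', f B B' ≤ (Matrix.of fun x y => if (colourI (row x) ∈ B ∧ colourJ (row x) ∈ B') ∧
      (colourI (col y) ∉ B ∧ colourJ (col y) ∉ B') then D x y else 0).rank := by
    intro B B'
    have e : (Matrix.of fun a b => if pS B B' a ∧ (colourI (col (c b)) ∉ B ∧ colourJ (col (c b)) ∉ B')
        then M a b else 0) =
        (Matrix.of fun x y => if (colourI (row x) ∈ B ∧ colourJ (row x) ∈ B') ∧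
          (colourI (col y) ∉ B ∧ colourJ (col y) ∉ B') then D x y else 0).submatrix r c := by
      ext a b
      simp only [hM, hR₀, Matrix.submatrix_apply, Matrix.of_apply, pS]
      by_cases h1 : colourI (row (r a)) ∈ B ∧ colourJ (row (r a)) ∈ B'
      · by_cases h2 : colourI (col (c b)) ∉ B ∧ colourJ (col (c b)) ∉ B'
        · simp [h1, h2, hrow a, hcol b]
        · simp [h2]
      · simp [h1]
    simp only [f]
    rw [e]
    exact Matrix.rank_submatrix_le _ _ _
  -- the colour sets of the minor's columns, disjoint from those of its rows
  set P : Finset (Fin n → Bool) := Finset.univ.image fun b => colourI (col (c b)) with hP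
  set Q : Finset (Fin n' → Bool) := Finset.univ.image fun b => colourJ (col (c b)) with hQ
  have hrowP : ∀ a, colourI (row (r a)) ∉ P := by
    intro a h
    obtain ⟨b, -, hb⟩ := Finset.mem_image.mp h
    exact (hcol b).1 (hb ▸ (hrow a).1)
  have hrowQ : ∀ a, colourJ (row (r a)) ∉ Q := by
    intro a h
    obtain ⟨b, -, hb⟩ := Finset.mem_image.mp h
    exact (hcol b).2 (hb ▸ (hrow a).2)
  have hcolP : ∀ b, colourI (col (c b)) ∈ P := fun b => Finset.mem_image.mpr ⟨b, Finset.mem_univ _, rfl⟩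
  have hcolQ : ∀ b, colourJ (col (c b)) ∈ Q := fun b => Finset.mem_image.mpr ⟨b, Finset.mem_univ _, rfl⟩
  -- flipping `B` on `P` (resp. `B'` on `Q`) keeps the surviving rows and complements the column condition
  have pS_flipI : ∀ B B' a, pS (B ∆ P) B' a ↔ pS B B' a := by
    intro B B' a
    simp only [pS, Finset.mem_symmDiff, hrowP a, not_false_eq_true, and_true, false_and, or_false]
  have pS_flipJ : ∀ B B' a, pS B (B' ∆ Q) a ↔ pS B B' a := by
    intro B B' a
    simp only [pS, Finset.mem_symmDiff, hrowQ a, not_false_eq_true, and_true, false_and, or_false]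
  have colI_flip : ∀ B b, colourI (col (c b)) ∉ B ∆ P ↔ colourI (col (c b)) ∈ B := by
    intro B b
    simp [Finset.mem_symmDiff, hcolP b]
  have colJ_flip : ∀ B' b, colourJ (col (c b)) ∉ B' ∆ Q ↔ colourJ (col (c b)) ∈ B' := by
    intro B' b
    simp [Finset.mem_symmDiff, hcolQ b]
  -- Step C: the four rectangle pieces of an orbit carry at least the number of surviving rows
  have stepC : ∀ B B', Fintype.card {a : Fin s // pS B B' a} ≤
      f B B' + f (B ∆ P) B' + f B (B' ∆ Q) + f (B ∆ P) (B' ∆ Q) := by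
    intro B B'
    let u : Fin s → Bool := fun b => decide (colourI (col (c b)) ∉ B)
    let v : Fin s → Bool := fun b => decide (colourJ (col (c b)) ∉ B')
    have key := card_le_sum_four_masks M hdet (pS B B') u v
    have e1 : (Matrix.of fun a b => if pS B B' a ∧ (u b = true ∧ v b = true) then M a b else 0) =
        (Matrix.of fun a b => if pS B B' a ∧ (colourI (col (c b)) ∉ B ∧ colourJ (col (c b)) ∉ B') then M a b else 0) := by
      ext a b; simp [u, v]
    have e2 : (Matrix.of fun a b => if pS B B' a ∧ (u b = false ∧ v b = true) then M a b else 0) =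
        (Matrix.of fun a b => if pS (B ∆ P) B' a ∧ (colourI (col (c b)) ∉ B ∆ P ∧ colourJ (col (c b)) ∉ B')
          then M a b else 0) := by
      ext a b; simp only [Matrix.of_apply, pS_flipI, colI_flip, u, v, decide_eq_false_iff_not, not_not,
        decide_eq_true_eq]
    have e3 : (Matrix.of fun a b => if pS B B' a ∧ (u b = true ∧ v b = false) then M a b else 0) =
        (Matrix.of fun a b => if pS B (B' ∆ Q) a ∧ (colourI (col (c b)) ∉ B ∧ colourJ (col (c b)) ∉ B' ∆ Q)
          then M a b else 0) := by
      ext a b; simp only [Matrix.of_apply, pS_flipJ, colJ_flip, u, v, decide_eq_false_iff_not, not_not,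
        decide_eq_true_eq]
    have e4 : (Matrix.of fun a b => if pS B B' a ∧ (u b = false ∧ v b = false) then M a b else 0) =
        (Matrix.of fun a b => if pS (B ∆ P) (B' ∆ Q) a ∧
          (colourI (col (c b)) ∉ B ∆ P ∧ colourJ (col (c b)) ∉ B' ∆ Q) then M a b else 0) := by
      ext a b
      simp only [Matrix.of_apply, pS_flipI, pS_flipJ, colI_flip, colJ_flip, u, v, decide_eq_false_iff_not, not_not]
    simp only [f]
    rw [← e1, ← e2, ← e3, ← e4]
    exact key
  -- Step D: summing over all `(B,B')`; the flips are bijections of the index sets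
  have flipB : ∀ g : Finset (Fin n → Bool) → ℕ, ∑ B, g (B ∆ P) = ∑ B, g B := fun g =>
    Fintype.sum_equiv (Equiv.mk (fun B => B ∆ P) (fun B => B ∆ P)
      (fun B => symmDiff_symmDiff_cancel_right _ _) (fun B => symmDiff_symmDiff_cancel_right _ _)) _ _ (fun _ => rfl)
  have flipB' : ∀ g : Finset (Fin n' → Bool) → ℕ, ∑ B', g (B' ∆ Q) = ∑ B', g B' := fun g =>
    Fintype.sum_equiv (Equiv.mk (fun B' => B' ∆ Q) (fun B' => B' ∆ Q)
      (fun B' => symmDiff_symmDiff_cancel_right _ _) (fun B' => symmDiff_symmDiff_cancel_right _ _)) _ _ (fun _ => rfl)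
  have sumC : ∑ B : Finset (Fin n → Bool), ∑ B' : Finset (Fin n' → Bool), Fintype.card {a : Fin s // pS B B' a} ≤
      4 * ∑ B : Finset (Fin n → Bool), ∑ B' : Finset (Fin n' → Bool), f B B' := by
    calc ∑ B : Finset (Fin n → Bool), ∑ B' : Finset (Fin n' → Bool), Fintype.card {a : Fin s // pS B B' a}
        ≤ ∑ B : Finset (Fin n → Bool), ∑ B' : Finset (Fin n' → Bool),
            (f B B' + f (B ∆ P) B' + f B (B' ∆ Q) + f (B ∆ P) (B' ∆ Q)) :=
          Finset.sum_le_sum fun B _ => Finset.sum_le_sum fun B' _ => stepC B B'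
      _ = ∑ B, ∑ B', f B B' + ∑ B, ∑ B', f (B ∆ P) B' + ∑ B, ∑ B', f B (B' ∆ Q) +
            ∑ B, ∑ B', f (B ∆ P) (B' ∆ Q) := by
          simp only [Finset.sum_add_distrib]
      _ = 4 * ∑ B, ∑ B', f B B' := by
          rw [flipB (fun B => ∑ B', f B B')]
          conv_lhs => rw [show (∑ B, ∑ B', f B (B' ∆ Q)) = ∑ B, ∑ B', f B B' from
            Finset.sum_congr rfl fun B _ => flipB' (fun B' => f B B')]
          conv_lhs => rw [show (∑ B, ∑ B', f (B ∆ P) (B' ∆ Q)) = ∑ B, ∑ B', f B B' from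
            (flipB (fun B => ∑ B', f B (B' ∆ Q))).trans (Finset.sum_congr rfl fun B _ => flipB' (fun B' => f B B'))]
          ring
  -- the left-hand side counts, for each row of the minor, a quarter of all `(B,B')`
  have count : 4 * ∑ B : Finset (Fin n → Bool), ∑ B' : Finset (Fin n' → Bool), Fintype.card {a : Fin s // pS B B' a} =
      Fintype.card (Finset (Fin n → Bool)) * Fintype.card (Finset (Fin n' → Bool)) * s := by
    let gI : Fin s → Finset (Fin n → Bool) → ℕ := fun a B => if colourI (row (r a)) ∈ B then 1 else 0
    let gJ : Fin s → Finset (Fin n' → Bool) → ℕ := fun a B' => if colourJ (row (r a)) ∈ B' then 1 else 0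
    have e1 : ∀ B B', Fintype.card {a : Fin s // pS B B' a} = ∑ a : Fin s, gI a B * gJ a B' := by
      intro B B'
      rw [Fintype.card_subtype, Finset.card_eq_sum_ones, Finset.sum_filter]
      refine Finset.sum_congr rfl fun a _ => ?_
      by_cases h1 : colourI (row (r a)) ∈ B <;> by_cases h2 : colourJ (row (r a)) ∈ B' <;> simp [pS, gI, gJ, h1, h2]
    have e2 : (∑ B : Finset (Fin n → Bool), ∑ B' : Finset (Fin n' → Bool), ∑ a : Fin s, gI a B * gJ a B') =
        ∑ a : Fin s, ((∑ B : Finset (Fin n → Bool), gI a B) * ∑ B' : Finset (Fin n' → Bool), gJ a B') := by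
      rw [Finset.sum_congr rfl (fun B _ => Finset.sum_comm), Finset.sum_comm]
      refine Finset.sum_congr rfl fun a _ => ?_
      rw [Finset.sum_mul_sum]
    have e3 : ∀ a : Fin s, 4 * ((∑ B : Finset (Fin n → Bool), gI a B) * ∑ B' : Finset (Fin n' → Bool), gJ a B') =
        Fintype.card (Finset (Fin n → Bool)) * Fintype.card (Finset (Fin n' → Bool)) := by
      intro a
      rw [← two_mul_sum_indicator_mem (colourI (row (r a))), ← two_mul_sum_indicator_mem (colourJ (row (r a)))]
      simp only [gI, gJ]
      ring
    simp_rw [e1]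
    rw [e2, Finset.mul_sum]
    simp_rw [e3]
    rw [Finset.sum_const, Finset.card_univ, Fintype.card_fin, smul_eq_mul]
    ring
  -- assemble
  have sumA : ∑ B : Finset (Fin n → Bool), ∑ B' : Finset (Fin n' → Bool), f B B' ≤
      ∑ B : Finset (Fin n → Bool), ∑ B' : Finset (Fin n' → Bool),
        (Matrix.of fun x y => if (colourI (row x) ∈ B ∧ colourJ (row x) ∈ B') ∧
            (colourI (col y) ∉ B ∧ colourJ (col y) ∉ B') then D x y else 0).rank :=
    Finset.sum_le_sum fun B _ => Finset.sum_le_sum fun B' _ => stepA B B'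
  calc Fintype.card (Finset (Fin n → Bool)) * Fintype.card (Finset (Fin n' → Bool)) * s
      = 4 * ∑ B : Finset (Fin n → Bool), ∑ B' : Finset (Fin n' → Bool), Fintype.card {a : Fin s // pS B B' a} :=
        count.symm
    _ ≤ 4 * (4 * ∑ B : Finset (Fin n → Bool), ∑ B' : Finset (Fin n' → Bool), f B B') := Nat.mul_le_mul_left 4 sumC
    _ ≤ 4 * (4 * ∑ B : Finset (Fin n → Bool), ∑ B' : Finset (Fin n' → Bool),
        (Matrix.of fun x y => if (colourI (row x) ∈ B ∧ colourJ (row x) ∈ B') ∧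
            (colourI (col y) ∉ B ∧ colourJ (col y) ∉ B') then D x y else 0).rank) :=
        Nat.mul_le_mul_left 4 (Nat.mul_le_mul_left 4 sumA)
    _ = _ := by ring

end Summit.PneNP.PneNP.Theorems.CnfIdealGenLengthRankDefectRepresentationsRectangleSpread
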